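import Literature.MathematicalPhysics.QuantumLattice.HubbardMatsubaraCutoffBlocks
import Literature.MathematicalPhysics.QuantumLattice.MatsubaraTruncationRemainder
import HarnessLib

/-!
# The Matsubara shell between two cutoffs `M ≤ M″`: reindexing and the elementary sums (`O(1/M)`)

Topic `MathematicalPhysics/QuantumLattice`; companion of `HubbardMatsubaraCutoffEmbedding/Blocks/EffAction.lean`
(the exact embedding of the cutoff-`M` Hubbard torus into the cutoff-`M″` one; `π`, `ι`, the shell covariance
`S = hubbardCovShellCT`) and of `MatsubaraTruncationRemainder.lean` (one-sided re-indexing of truncated frequency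
sums).  The SHELL is the set of labels at cutoff `M″` outside the window, i.e. the integers `M ≤ n < M″` and
`-M″ ≤ n < -M`, frequencies `±ν_n`, `ν_n = (2n+1)π/β`, `M ≤ n < M″` — Pedra–Salmhofer's ultraviolet part `C_{Ω,>}`
of the frequency split (§5) for the SHARP truncations of the tree.  This file supplies the finite-sum bookkeeping
every estimate of a shell integration starts from:

* §1 `MatsubaraIdx.shell h` (a `Finset`, decidable description by the integer label), `mem_shell_iff`
  (`↔ ∉ Set.range (emb h)`), the splitting `Σ_{M″} = Σ_shell + Σ_M` (`sum_shell_add_sum_emb`) and the one-sided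
  form **`sum_shell_freq_eq`**: `Σ_{j ∈ shell} f(ω_j) = Σ_{n ∈ [M, M″)} (f(ν_n) + f(−ν_n))`;
* §2 the numbers, all `O(1/M)` uniformly in `M″` and `β`-explicit: sup `1/|ω_j| ≤ β/(π(2M+1))`;
  `Σ_{n∈[M,M″)} 1/(2n+1)² ≤ 1/(4M)`; **`Σ_shell 1/(ω_j² + a²) ≤ β²/(2π²M)`**; the symmetric TADPOLE
  `Σ_shell 1/(−iω_j + a) = Σ_{n∈[M,M″)} 2a/(ν_n² + a²)` (real: the shell is reflection symmetric) with
  **`‖Σ_shell 1/(−iω_j + a)‖ ≤ |a|β²/(2π²M)`**; the Fourier–Gram sum `Σ_shell 1/|ω_j| ≤ 2(M″−M)β/(π(2M+1))`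
  (`< 2β/π·…` for a dyadic shell `M″ ≤ 2M`: compare cutoffs DYADICALLY);
* §3 entry bounds: `‖G^K(k)_{ab}‖ ≤ 1/|ω(k)|` for the Nambu propagator in any frame and seed
  (`norm_nambuPropagatorCT_le`), `‖C^K(X,Y)‖ ≤ βL²/|ω_X|`, and **`‖S(X″,Y″)‖ ≤ βL²·β/(π(2M+1))`** for the shell
  covariance.

Everything is proved; `MatsubaraIdx.shell` is the only definition; no named fact.

## Sources

W. de S. Pedra, M. Salmhofer, Commun. Math. Phys. 282 (2008) 797–818, §5 (the frequency split `C = C_{Ω,<} + C_{Ω,>}`,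
Lemma 5.1–5.2: Gram and decay constants of the ultraviolet part) [`PedraSalmhofer2008`]; G. Benfatto, A. Giuliani,
V. Mastropietro, Ann. Henri Poincaré 7 (2006) 809–898, §2.1 (2.3)–(2.6) (the truncated frequency sums and `M → ∞`)
[`BenfattoGiulianiMastropietro2006`].  The `[cite: …]` tags LOCATE the construct each statement is about; the
statements are elementary bookkeeping / estimates, not named results of those sources.
-/

noncomputable section

namespace Literature.MathematicalPhysics.QuantumLattice

open Finset Complex
open scoped Real

/-! ### §1 The shell and the one-sided re-indexing -/

namespace MatsubaraIdx

variable {M M'' : ℕ}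

/-- **The shell** of labels at cutoff `M″` outside the window of cutoff `M`: integer label `n ≥ M` or `n < -M`
(Pedra–Salmhofer's ultraviolet frequencies `|ω| > Ω` for the sharp truncations). [cite: PedraSalmhofer2008, §5 Lemma 5.1] -/
def shell (_h : M ≤ M'') : Finset (MatsubaraIdx M'') :=
  univ.filter fun j => ¬(-(M : ℤ) ≤ matsubaraInt M'' j ∧ matsubaraInt M'' j < M)

/-- Membership in the shell is non-membership in the window. [cite: PedraSalmhofer2008, §5 Lemma 5.1] -/
theorem mem_shell_iff (h : M ≤ M'') (j : MatsubaraIdx M'') : j ∈ shell h ↔ j ∉ Set.range (emb h) := by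
  rw [shell, mem_filter, mem_range_emb_iff]
  simp only [mem_univ, true_and]

/-- The window, as a finset, is the image of the embedding. [cite: PedraSalmhofer2008, §5 Lemma 5.1] -/
theorem filter_window_eq_image (h : M ≤ M'') :
    (univ.filter fun j : MatsubaraIdx M'' => -(M : ℤ) ≤ matsubaraInt M'' j ∧ matsubaraInt M'' j < M) = univ.image (emb h) := by
  ext j
  rw [mem_filter, mem_image, ← mem_range_emb_iff h]
  simp only [mem_univ, true_and, Set.mem_range]

/-- **Splitting a sum at cutoff `M″` into shell and window**: `Σ_{j ∈ shell} f j + Σ_i f (emb i) = Σ_j f j`.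
[cite: PedraSalmhofer2008, §5 Lemma 5.1] -/
theorem sum_shell_add_sum_emb {α : Type*} [AddCommMonoid α] (h : M ≤ M'') (f : MatsubaraIdx M'' → α) :
    ∑ j ∈ shell h, f j + ∑ i : MatsubaraIdx M, f (emb h i) = ∑ j, f j := by
  rw [shell, ← Finset.sum_image (s := univ) (g := emb h) (f := f) fun x _ y _ hxy => emb_injective h hxy,
    ← filter_window_eq_image h, add_comm]
  exact Finset.sum_filter_add_sum_filter_not _ _ _

/-- The cardinality of the shell is `2(M″ − M)`. [cite: PedraSalmhofer2008, §5 Lemma 5.1] -/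
theorem card_shell (h : M ≤ M'') : (shell h).card = 2 * (M'' - M) := by
  have hsum := sum_shell_add_sum_emb h (fun _ => (1 : ℕ))
  simp only [sum_const, smul_eq_mul, mul_one, card_univ, Fintype.card_fin] at hsum
  omega

end MatsubaraIdx

section Sums

variable {M M'' : ℕ}

/-- **One-sided form of a shell sum**: `Σ_{j ∈ shell} f(ω_j) = Σ_{n ∈ [M, M″)} (f(ν_n) + f(−ν_n))`, `ν_n = (2n+1)π/β`.
[cite: PedraSalmhofer2008, §5 Lemma 5.1] -/
theorem sum_shell_freq_eq {α : Type*} [AddCommGroup α] (h : M ≤ M'') (β : ℝ) (f : ℝ → α) :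
    ∑ j ∈ MatsubaraIdx.shell h, f (matsubaraFreq β M'' j) =
      ∑ n ∈ Ico M M'', (f ((2 * n + 1) * π / β) + f (-((2 * n + 1) * π / β))) := by
  have hsplit := MatsubaraIdx.sum_shell_add_sum_emb h (fun j => f (matsubaraFreq β M'' j))
  simp only [matsubaraFreq_emb] at hsplit
  rw [sum_matsubaraIdx_freq_eq_sum_range β M'' f, sum_matsubaraIdx_freq_eq_sum_range β M f] at hsplit
  rw [sum_add_distrib, Finset.sum_Ico_eq_sub _ h, Finset.sum_Ico_eq_sub _ h]
  rw [← add_sub_add_comm, ← hsplit]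
  abel

/-! ### §2 The shell numbers -/

/-- **Sup bound on the shell**: `1/|ω_j| ≤ β/(π(2M+1))`. [cite: PedraSalmhofer2008, §5 Lemma 5.2] -/
theorem one_div_abs_matsubaraFreq_le_of_mem_shell {β : ℝ} (hβ : 0 < β) (h : M ≤ M'') {j : MatsubaraIdx M''}
    (hj : j ∈ MatsubaraIdx.shell h) : 1 / |matsubaraFreq β M'' j| ≤ β / (Real.pi * (2 * M + 1)) := by
  have hfl := le_abs_matsubaraFreq_of_not_mem_range hβ h ((MatsubaraIdx.mem_shell_iff h j).1 hj)
  have hpos : 0 < Real.pi * (2 * M + 1) / β := by positivity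
  calc 1 / |matsubaraFreq β M'' j| ≤ 1 / (Real.pi * (2 * M + 1) / β) := one_div_le_one_div_of_le hpos hfl
    _ = β / (Real.pi * (2 * M + 1)) := one_div_div _ _

/-- The telescoping tail: `Σ_{n ∈ [M, M″)} (1/n − 1/(n+1)) = 1/M − 1/M″` (`1 ≤ M`). [cite: PedraSalmhofer2008, §5 Lemma 5.2] -/
theorem sum_Ico_one_div_sub_one_div_succ (h : M ≤ M'') :
    ∑ n ∈ Ico M M'', (1 / (n : ℝ) - 1 / ((n : ℝ) + 1)) = 1 / (M : ℝ) - 1 / (M'' : ℝ) := by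
  induction M'', h using Nat.le_induction with
  | base => simp
  | succ k hk ih =>
    rw [Finset.sum_Ico_succ_top hk, ih]
    push_cast
    ring

/-- **`Σ_{n ∈ [M, M″)} 1/(2n+1)² ≤ 1/(4M)`** (`1 ≤ M`; `1/(2n+1)² ≤ ¼(1/n − 1/(n+1))`). [cite: PedraSalmhofer2008, §5 Lemma 5.2] -/
theorem sum_Ico_one_div_odd_sq_le (hM : 1 ≤ M) (h : M ≤ M'') :
    ∑ n ∈ Ico M M'', 1 / ((2 * (n : ℝ) + 1) ^ 2) ≤ 1 / (4 * (M : ℝ)) := by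
  have hterm : ∀ n ∈ Ico M M'', 1 / ((2 * (n : ℝ) + 1) ^ 2) ≤ (1 / 4) * (1 / (n : ℝ) - 1 / ((n : ℝ) + 1)) := by
    intro n hn
    have hn1 : (1 : ℝ) ≤ n := by exact_mod_cast hM.trans (mem_Ico.1 hn).1
    have hn0 : (0 : ℝ) < n := by linarith
    have hre : (1 / 4 : ℝ) * (1 / (n : ℝ) - 1 / ((n : ℝ) + 1)) = 1 / (4 * n * (n + 1)) := by
      field_simp
      ring
    rw [hre]
    apply one_div_le_one_div_of_le (by positivity)
    nlinarith
  refine (Finset.sum_le_sum hterm).trans ?_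
  rw [← Finset.mul_sum, sum_Ico_one_div_sub_one_div_succ h]
  have hM0 : (0 : ℝ) < M := by exact_mod_cast hM
  have hM''0 : (0 : ℝ) ≤ 1 / (M'' : ℝ) := by positivity
  rw [show 1 / (4 * (M : ℝ)) = 1 / 4 * (1 / M) by rw [one_div_mul_one_div]]
  gcongr
  linarith

/-- **`Σ_shell 1/(ω_j² + a²) ≤ β²/(2π²M)`** (`0 < β`, `1 ≤ M`; any `a`, any `M″ ≥ M`): the `L²(dτ)` size of a shell line.
[cite: PedraSalmhofer2008, §5 Lemma 5.2] -/
theorem sum_shell_one_div_sq_add_sq_le {β : ℝ} (hβ : 0 < β) (hM : 1 ≤ M) (h : M ≤ M'') (a : ℝ) :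
    ∑ j ∈ MatsubaraIdx.shell h, 1 / (matsubaraFreq β M'' j ^ 2 + a ^ 2) ≤ β ^ 2 / (2 * Real.pi ^ 2 * M) := by
  rw [sum_shell_freq_eq h β (fun ω => 1 / (ω ^ 2 + a ^ 2))]
  simp only [neg_sq]
  have hterm : ∀ n ∈ Ico M M'', 1 / (((2 * (n : ℝ) + 1) * π / β) ^ 2 + a ^ 2) + 1 / (((2 * (n : ℝ) + 1) * π / β) ^ 2 + a ^ 2) ≤
      2 * (β ^ 2 / π ^ 2) * (1 / ((2 * (n : ℝ) + 1) ^ 2)) := by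
    intro n _
    rw [← two_mul, mul_assoc]
    refine mul_le_mul_of_nonneg_left ?_ (by norm_num)
    rw [div_mul_div_comm, mul_one, div_le_div_iff₀ (by positivity) (by positivity), one_mul]
    have : β ^ 2 * (((2 * (n : ℝ) + 1) * π / β) ^ 2) = π ^ 2 * (2 * (n : ℝ) + 1) ^ 2 := by
      field_simp
    nlinarith [sq_nonneg a, Real.pi_pos]
  refine (Finset.sum_le_sum hterm).trans ?_
  rw [← Finset.mul_sum]
  calc 2 * (β ^ 2 / π ^ 2) * ∑ n ∈ Ico M M'', 1 / ((2 * (n : ℝ) + 1) ^ 2) ≤ 2 * (β ^ 2 / π ^ 2) * (1 / (4 * (M : ℝ))) :=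
        mul_le_mul_of_nonneg_left (sum_Ico_one_div_odd_sq_le hM h) (by positivity)
    _ = β ^ 2 / (2 * Real.pi ^ 2 * M) := by
        have hM0 : (0 : ℝ) < M := by exact_mod_cast hM
        field_simp
        ring

/-- **`Σ_shell 1/ω_j² ≤ β²/(2π²M)`** (`0 < β`, `1 ≤ M`). [cite: PedraSalmhofer2008, §5 Lemma 5.2] -/
theorem sum_shell_one_div_sq_le {β : ℝ} (hβ : 0 < β) (hM : 1 ≤ M) (h : M ≤ M'') :
    ∑ j ∈ MatsubaraIdx.shell h, 1 / matsubaraFreq β M'' j ^ 2 ≤ β ^ 2 / (2 * Real.pi ^ 2 * M) := by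
  have := sum_shell_one_div_sq_add_sq_le hβ hM h 0
  simpa using this

/-- **The shell tadpole is real and paired**: `Σ_shell 1/(−iω_j + a) = Σ_{n∈[M,M″)} 2a/(ν_n² + a²)` (the shell is
symmetric under `ω ↦ −ω`). [cite: BenfattoGiulianiMastropietro2006, §2.1 (2.3)–(2.6)] -/
theorem sum_shell_one_div_eq (h : M ≤ M'') (β a : ℝ) :
    ∑ j ∈ MatsubaraIdx.shell h, 1 / (-I * matsubaraFreq β M'' j + a) =
      ∑ n ∈ Ico M M'', (((2 * a / (((2 * n + 1) * π / β) ^ 2 + a ^ 2) : ℝ) : ℂ)) := by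
  rw [sum_shell_freq_eq h β (fun ω => 1 / (-I * (ω : ℂ) + a))]
  refine Finset.sum_congr rfl fun n _ => ?_
  set ν : ℝ := (2 * n + 1) * π / β
  have hD : ((ν : ℂ) ^ 2 + (a : ℂ) ^ 2) = (-I * ν + a) * (I * ν + a) := by ring_nf; rw [I_sq]; ring
  by_cases hz : (ν : ℝ) ^ 2 + a ^ 2 = 0
  · have hν : ν = 0 := by nlinarith [sq_nonneg ν, sq_nonneg a]
    have ha : a = 0 := by nlinarith [sq_nonneg ν, sq_nonneg a]
    simp [hν, ha]
  · have hz' : ((ν : ℂ) ^ 2 + (a : ℂ) ^ 2) ≠ 0 := by exact_mod_cast hz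
    have h1 : (-I * (ν : ℂ) + a) ≠ 0 := fun h0 => hz' (by rw [hD, h0, zero_mul])
    have h2 : (I * (ν : ℂ) + a) ≠ 0 := fun h0 => hz' (by rw [hD, h0, mul_zero])
    push_cast
    rw [show -I * -(ν : ℂ) + a = I * ν + a by ring, div_add_div _ _ h1 h2, ← hD]
    congr 1
    ring

/-- **The shell tadpole is `O(1/M)`**: `‖Σ_shell 1/(−iω_j + a)‖ ≤ |a|β²/(2π²M)` (`0 < β`, `1 ≤ M`): the Hartree shift
carried by the shell frequencies. [cite: BenfattoGiulianiMastropietro2006, §2.1 (2.3)–(2.6)] -/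
theorem norm_sum_shell_one_div_le {β : ℝ} (hβ : 0 < β) (hM : 1 ≤ M) (h : M ≤ M'') (a : ℝ) :
    ‖∑ j ∈ MatsubaraIdx.shell h, 1 / (-I * matsubaraFreq β M'' j + a)‖ ≤ |a| * (β ^ 2 / (2 * Real.pi ^ 2 * M)) := by
  rw [sum_shell_one_div_eq h β a, ← Complex.ofReal_sum, Complex.norm_real, Real.norm_eq_abs]
  have hpt : ∀ n ∈ Ico M M'', |2 * a / (((2 * (n : ℝ) + 1) * π / β) ^ 2 + a ^ 2)| ≤
      |a| * (1 / (((2 * (n : ℝ) + 1) * π / β) ^ 2 + a ^ 2) + 1 / (((2 * (n : ℝ) + 1) * π / β) ^ 2 + a ^ 2)) := by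
    intro n _
    have hpos : 0 < ((2 * (n : ℝ) + 1) * π / β) ^ 2 + a ^ 2 := by positivity
    rw [abs_div, abs_of_pos hpos, abs_mul, abs_two, ← two_mul, ← mul_assoc, mul_comm |a| 2, mul_one_div]
  calc |∑ n ∈ Ico M M'', 2 * a / (((2 * (n : ℝ) + 1) * π / β) ^ 2 + a ^ 2)|
      ≤ ∑ n ∈ Ico M M'', |2 * a / (((2 * (n : ℝ) + 1) * π / β) ^ 2 + a ^ 2)| := Finset.abs_sum_le_sum_abs _ _
    _ ≤ ∑ n ∈ Ico M M'', |a| * (1 / (((2 * (n : ℝ) + 1) * π / β) ^ 2 + a ^ 2) + 1 / (((2 * (n : ℝ) + 1) * π / β) ^ 2 + a ^ 2)) :=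
        Finset.sum_le_sum hpt
    _ = |a| * ∑ j ∈ MatsubaraIdx.shell h, 1 / (matsubaraFreq β M'' j ^ 2 + a ^ 2) := by
        rw [← Finset.mul_sum, sum_shell_freq_eq h β (fun ω => 1 / (ω ^ 2 + a ^ 2))]
        simp only [neg_sq]
    _ ≤ |a| * (β ^ 2 / (2 * Real.pi ^ 2 * M)) := mul_le_mul_of_nonneg_left (sum_shell_one_div_sq_add_sq_le hβ hM h a) (abs_nonneg a)

/-- **The Fourier–Gram sum of the shell**: `Σ_shell 1/|ω_j| ≤ 2(M″−M)·β/(π(2M+1))` — bounded for a DYADIC shell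
`M″ ≤ 2M`, logarithmic in `M″/M` in general (compare cutoffs dyadically). [cite: PedraSalmhofer2008, §5 Lemma 5.1] -/
theorem sum_shell_one_div_abs_le {β : ℝ} (hβ : 0 < β) (h : M ≤ M'') :
    ∑ j ∈ MatsubaraIdx.shell h, 1 / |matsubaraFreq β M'' j| ≤ 2 * ((M'' : ℝ) - M) * (β / (Real.pi * (2 * M + 1))) := by
  calc ∑ j ∈ MatsubaraIdx.shell h, 1 / |matsubaraFreq β M'' j|
      ≤ ∑ j ∈ MatsubaraIdx.shell h, β / (Real.pi * (2 * M + 1)) :=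
        Finset.sum_le_sum fun j hj => one_div_abs_matsubaraFreq_le_of_mem_shell hβ h hj
    _ = 2 * ((M'' : ℝ) - M) * (β / (Real.pi * (2 * M + 1))) := by
        rw [Finset.sum_const, MatsubaraIdx.card_shell h, nsmul_eq_mul]
        simp only [Nat.cast_mul, Nat.cast_ofNat, Nat.cast_sub h]

/-- `‖1/(−iω + a)‖ ≤ 1/|ω|` for real `ω ≠ 0`, `a`. [cite: BenfattoGiulianiMastropietro2006, §2.1 (2.3)] -/
theorem norm_one_div_neg_I_mul_add_le {ω : ℝ} (hω : ω ≠ 0) (a : ℝ) : ‖1 / (-I * (ω : ℂ) + a)‖ ≤ 1 / |ω| := by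
  have hn : ‖-I * (ω : ℂ) + a‖ = Real.sqrt (ω ^ 2 + a ^ 2) := by
    rw [show -I * (ω : ℂ) + a = ((a : ℝ) : ℂ) + ((-ω : ℝ) : ℂ) * I by push_cast; ring, Complex.norm_add_mul_I,
      show a ^ 2 + (-ω) ^ 2 = ω ^ 2 + a ^ 2 by ring]
  have hω2 : 0 < ω ^ 2 + a ^ 2 := by positivity
  rw [norm_div, norm_one, hn, one_div_le_one_div (Real.sqrt_pos.2 hω2) (abs_pos.2 hω), ← Real.sqrt_sq_eq_abs]
  exact Real.sqrt_le_sqrt (by nlinarith [sq_nonneg a])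

end Sums

/-! ### §3 Entry bounds: the Nambu propagator, the covariance, the shell covariance -/

section Entries

variable {L N : ℕ}

/-- `‖(iω ± e)/(ω² + e² + Δ²)‖ ≤ 1/|ω|` (`ω ≠ 0`). [cite: BenfattoGiulianiMastropietro2006, §2.1 (2.3)] -/
theorem norm_I_mul_add_div_le {ω : ℝ} (hω : ω ≠ 0) (e Δ2 : ℝ) (hΔ : 0 ≤ Δ2) :
    ‖(I * (ω : ℂ) + e) / ((ω ^ 2 + e ^ 2 + Δ2 : ℝ) : ℂ)‖ ≤ 1 / |ω| := by
  have hn : ‖I * (ω : ℂ) + e‖ = Real.sqrt (ω ^ 2 + e ^ 2) := by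
    rw [show I * (ω : ℂ) + e = ((e : ℝ) : ℂ) + ((ω : ℝ) : ℂ) * I by ring, Complex.norm_add_mul_I, add_comm]
  have hs : 0 < ω ^ 2 + e ^ 2 := by positivity
  have hD : 0 < ω ^ 2 + e ^ 2 + Δ2 := by positivity
  rw [norm_div, Complex.norm_real, Real.norm_of_nonneg hD.le, hn, div_le_div_iff₀ hD (abs_pos.2 hω), one_mul]
  have h1 : Real.sqrt (ω ^ 2 + e ^ 2) * |ω| ≤ ω ^ 2 + e ^ 2 := by
    calc Real.sqrt (ω ^ 2 + e ^ 2) * |ω| ≤ Real.sqrt (ω ^ 2 + e ^ 2) * Real.sqrt (ω ^ 2 + e ^ 2) := by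
          refine mul_le_mul_of_nonneg_left ?_ (Real.sqrt_nonneg _)
          rw [← Real.sqrt_sq_eq_abs]
          exact Real.sqrt_le_sqrt (by nlinarith [sq_nonneg e])
      _ = ω ^ 2 + e ^ 2 := Real.mul_self_sqrt hs.le
  linarith

/-- `‖Δ/(ω² + e² + Δ²)‖ ≤ 1/|ω|` (`ω ≠ 0`; `ω² + Δ² ≥ 2|ω||Δ|`). [cite: BenfattoGiulianiMastropietro2006, §2.1 (2.3)] -/
theorem norm_ofReal_div_le {ω : ℝ} (hω : ω ≠ 0) (e Δ : ℝ) :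
    ‖((Δ : ℝ) : ℂ) / ((ω ^ 2 + e ^ 2 + Δ ^ 2 : ℝ) : ℂ)‖ ≤ 1 / |ω| := by
  have hD : 0 < ω ^ 2 + e ^ 2 + Δ ^ 2 := by positivity
  rw [← Complex.ofReal_div, Complex.norm_real, Real.norm_eq_abs, abs_div, abs_of_pos hD,
    div_le_div_iff₀ hD (abs_pos.2 hω), one_mul]
  nlinarith [sq_abs Δ, sq_abs ω, sq_nonneg (|Δ| - |ω|), abs_nonneg Δ, abs_nonneg ω, sq_nonneg e]

/-- **Every entry of the Nambu propagator is at most `1/|ω|`** (any frame, any seed, `β ≠ 0`).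
[cite: BenfattoGiulianiMastropietro2006, §2.1 (2.3)] -/
theorem norm_nambuPropagatorCT_le {β : ℝ} (hβ : β ≠ 0) (μ hs : ℝ) (K : TrigPolyC4v) (k : FreqMomentum L N) (a b : Fin 2) :
    ‖nambuPropagatorCT L N β μ hs K k a b‖ ≤ 1 / |matsubaraFreq β N k.1| := by
  have hω := matsubaraFreq_ne_zero (M := N) hβ k.1
  set ω := matsubaraFreq β N k.1
  set e := nambuXiCT L μ K k.2
  set Δ := hs * dWaveSymbol L k.2
  have hden : (nambuDenCT L N β μ hs K k : ℝ) = ω ^ 2 + e ^ 2 + Δ ^ 2 := rfl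
  fin_cases a <;> fin_cases b
  · simp only [nambuPropagatorCT, Fin.zero_eta, Fin.isValue, Matrix.of_apply, Matrix.cons_val', Matrix.cons_val_zero,
      Matrix.cons_val_fin_one, hden]
    exact norm_I_mul_add_div_le hω e (Δ ^ 2) (sq_nonneg _)
  · simp only [nambuPropagatorCT, Fin.zero_eta, Fin.isValue, Fin.mk_one, Matrix.of_apply, Matrix.cons_val', Matrix.cons_val_zero,
      Matrix.cons_val_one, Matrix.cons_val_fin_one, hden]
    exact norm_ofReal_div_le hω e Δ
  · simp only [nambuPropagatorCT, Fin.zero_eta, Fin.isValue, Fin.mk_one, Matrix.of_apply, Matrix.cons_val', Matrix.cons_val_zero,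
      Matrix.cons_val_one, Matrix.cons_val_fin_one, hden]
    exact norm_ofReal_div_le hω e Δ
  · simp only [nambuPropagatorCT, Fin.isValue, Fin.mk_one, Matrix.of_apply, Matrix.cons_val', Matrix.cons_val_one,
      Matrix.cons_val_fin_one, hden]
    have := norm_I_mul_add_div_le hω (-e) (Δ ^ 2) (sq_nonneg _)
    rw [show (-e) ^ 2 = e ^ 2 by ring] at this
    simpa [sub_eq_add_neg] using this

/-- The Nambu two-point table is at most `βL²/|ω|`. [cite: BenfattoGiulianiMastropietro2006, §2.1 (2.3)] -/
theorem norm_nambuTwoPointCT_le {β : ℝ} (hβ : 0 < β) (μ hs : ℝ) (K : TrigPolyC4v) (X Y : (FreqMomentum L N × Fin 2) × Fin 2) :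
    ‖nambuTwoPointCT L N β μ hs K X Y‖ ≤ β * (L : ℝ) ^ 2 * (1 / |matsubaraFreq β N X.1.1.1|) := by
  rw [nambuTwoPointCT]
  split_ifs
  · rw [norm_mul, Complex.norm_real, Real.norm_of_nonneg (by positivity)]
    exact mul_le_mul_of_nonneg_left (norm_nambuPropagatorCT_le hβ.ne' μ hs K _ _ _) (by positivity)
  · rw [norm_zero]; positivity

/-- The frequency of the Nambu label has the same size: `|ω((toNambu X).1.1)| = |ω(momentumOf X)|`.
[cite: BenfattoGiulianiMastropietro2006, §2.1 (2.3)] -/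
theorem abs_matsubaraFreq_toNambu (β : ℝ) (X : HubbardFieldIdx L N) :
    |matsubaraFreq β N (toNambu X).1.1.1| = |matsubaraFreq β N (momentumOf L N X).1| := by
  unfold toNambu momentumOf
  split_ifs
  · rfl
  · simp only [FreqMomentum.neg, matsubaraFreq_rev, abs_neg]

/-- **Every entry of the free covariance is at most `βL²/|ω_X|`** (any frame, any seed).
[cite: BenfattoGiulianiMastropietro2006, §2.1 (2.3)] -/
theorem norm_hubbardCovarianceCT_le {β : ℝ} (hβ : 0 < β) (μ hs : ℝ) (K : TrigPolyC4v) (X Y : HubbardFieldIdx L N) :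
    ‖hubbardCovarianceCT L N β μ hs K X Y‖ ≤ β * (L : ℝ) ^ 2 * (1 / |matsubaraFreq β N (momentumOf L N X).1|) := by
  rw [hubbardCovarianceCT, Matrix.of_apply, norm_neg, hubbardTwoPointCT]
  by_cases h1 : (toNambu X).2 = 1 ∧ (toNambu Y).2 = 0 ∧ (toNambu X).1.1 = (toNambu Y).1.1
  · have h2 : ¬((toNambu Y).2 = 1 ∧ (toNambu X).2 = 0 ∧ (toNambu Y).1.1 = (toNambu X).1.1) := by
      rintro ⟨h, -, -⟩; rw [h1.2.1] at h; exact absurd h (by decide)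
    rw [show nambuTwoPointCT L N β μ hs K (toNambu Y) (toNambu X) = 0 by rw [nambuTwoPointCT, if_neg h2], sub_zero,
      ← abs_matsubaraFreq_toNambu]
    exact norm_nambuTwoPointCT_le hβ μ hs K _ _
  · rw [show nambuTwoPointCT L N β μ hs K (toNambu X) (toNambu Y) = 0 by rw [nambuTwoPointCT, if_neg h1], zero_sub, norm_neg]
    by_cases h2 : (toNambu Y).2 = 1 ∧ (toNambu X).2 = 0 ∧ (toNambu Y).1.1 = (toNambu X).1.1
    · rw [← abs_matsubaraFreq_toNambu, ← h2.2.2]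
      exact norm_nambuTwoPointCT_le hβ μ hs K _ _
    · rw [show nambuTwoPointCT L N β μ hs K (toNambu Y) (toNambu X) = 0 by rw [nambuTwoPointCT, if_neg h2], norm_zero]
      positivity

/-- The cutoff weight lies in `[0, 1]`. [cite: PedraSalmhofer2008, §5 Lemma 5.1] -/
theorem hubbardCutoffWeightCT_mem_Icc (β μ : ℝ) (K : TrigPolyC4v) (Λ : ℝ) (k : FreqMomentum L N) :
    hubbardCutoffWeightCT L N β μ K Λ k ∈ Set.Icc (0 : ℝ) 1 :=
  salmhoferCutoff_mem_Icc _

/-- `‖C^K_{>Λ}(X,Y)‖ ≤ ‖C^K(X,Y)‖` (the symmetrised weight is in `[0,1]`). [cite: PedraSalmhofer2008, §5 Lemma 5.1] -/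
theorem norm_hubbardCovAboveCT_le (β μ hs : ℝ) (K : TrigPolyC4v) (Λ : ℝ) (X Y : HubbardFieldIdx L N) :
    ‖hubbardCovAboveCT L N β μ hs K Λ X Y‖ ≤ ‖hubbardCovarianceCT L N β μ hs K X Y‖ := by
  rw [hubbardCovAboveCT, Matrix.of_apply, norm_mul, Complex.norm_real]
  have h1 := hubbardCutoffWeightCT_mem_Icc β μ K Λ (momentumOf L N X)
  have h2 := hubbardCutoffWeightCT_mem_Icc β μ K Λ (momentumOf L N Y)
  have hw : ‖(hubbardCutoffWeightCT L N β μ K Λ (momentumOf L N X) + hubbardCutoffWeightCT L N β μ K Λ (momentumOf L N Y)) / 2‖ ≤ 1 := by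
    rw [Real.norm_of_nonneg (by linarith [h1.1, h2.1])]
    linarith [h1.2, h2.2]
  exact (mul_le_mul_of_nonneg_right hw (norm_nonneg _)).trans_eq (one_mul _)

variable [NeZero L] {M M'' : ℕ}

/-- **Every entry of the shell covariance is at most `βL²·β/(π(2M+1))`** (`0 < β`; window entries vanish, shell entries
are entries of `C″^K` at frequencies `|ω| ≥ π(2M+1)/β`). [cite: PedraSalmhofer2008, §5 Lemma 5.2] -/
theorem norm_hubbardCovShellCT_le {β : ℝ} (hβ : 0 < β) (h : M ≤ M'') (μ hs : ℝ) (K : TrigPolyC4v) (Λ : ℝ)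
    (X Y : HubbardFieldIdx L M'') :
    ‖hubbardCovShellCT L h β μ hs K Λ X Y‖ ≤ β * (L : ℝ) ^ 2 * (β / (Real.pi * (2 * M + 1))) := by
  by_cases hX : X ∈ Set.range (HubbardFieldIdx.emb (L := L) h)
  · obtain ⟨X, rfl⟩ := hX
    rw [hubbardCovShellCT_emb_left, norm_zero]; positivity
  by_cases hY : Y ∈ Set.range (HubbardFieldIdx.emb (L := L) h)
  · obtain ⟨Y, rfl⟩ := hY
    rw [hubbardCovShellCT_emb_right, norm_zero]; positivity
  rw [hubbardCovShellCT_of_not_mem h β μ hs K Λ hX hY]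
  have hX' : (momentumOf L M'' X).1 ∉ Set.range (MatsubaraIdx.emb h) := by
    rwa [HubbardFieldIdx.mem_range_emb_iff, FreqMomentum.mem_range_emb_iff] at hX
  calc ‖hubbardCovAboveCT L M'' β μ hs K Λ X Y‖ ≤ ‖hubbardCovarianceCT L M'' β μ hs K X Y‖ := norm_hubbardCovAboveCT_le _ _ _ _ _ _ _
    _ ≤ β * (L : ℝ) ^ 2 * (1 / |matsubaraFreq β M'' (momentumOf L M'' X).1|) := norm_hubbardCovarianceCT_le hβ μ hs K X Y
    _ ≤ β * (L : ℝ) ^ 2 * (β / (Real.pi * (2 * M + 1))) :=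
        mul_le_mul_of_nonneg_left (one_div_abs_matsubaraFreq_le_of_mem_shell hβ h ((MatsubaraIdx.mem_shell_iff h _).2 hX'))
          (by positivity)

end Entries

end Literature.MathematicalPhysics.QuantumLattice
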